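import Summits.MatrixMultiplication.MatrixMultiplication.Theorems.OutsiderSandwichToricCeilingPowTwoCwBaseDataC

/-!
# OutsiderSandwich — toric ceiling of `cw₂^{⊠N}`: the `N = 3` two-cw base census, kernel checks C
(groups `cX6`, `cX7`, `cX8`; decomp-mm lens 4, gen 47, kernel K47-6 census C; THESES-FREE, `ω`-free;
helper toward `LaserTangency`, stmt-32268)

LABEL.  TORIC · FINITE (`N = 3`) · NEC-side instrument.  For each group `cXk`: the certificate list
`datak` (`…TwoCwBaseDataC`) has the length of the instance list `instOf cXk` (`lenk`), and — in
CHUNKS of at most 150 instances, to respect the kernel's memory ceiling on the gate — every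
certificate decodes to a `valid` perfect matching of `cw ⊠ cw ⊠ D` minus its instance
(`censusk_r`, `decide +kernel`, standard axioms; no `native_decide`, no `ofReduceBool`); `coverk`
records that the chunks cover all indices.  Consumed by `…TwoCwBase` (`good_k`, `census_all`).
WHAT THIS IS NOT: no statement about tensors or `ω`.
-/

set_option linter.dupNamespace false
set_option maxRecDepth 200000
set_option Elab.async false

namespace Summit.MatrixMultiplication.MatrixMultiplication.Theorems.OutsiderSandwichToricCeilingPowTwoCwBaseCensusC

open Summit.MatrixMultiplication.MatrixMultiplication.Theorems.OutsiderSandwichToricCeilingPowTwoCwBaseDefs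
open Summit.MatrixMultiplication.MatrixMultiplication.Theorems.OutsiderSandwichToricCeilingPowTwoCwBaseDataC

set_option maxHeartbeats 0 in
/-- Group `cX6`: the certificate list has the length of the instance list (140). -/
theorem len6 : (instOf cX6).length = data6.length := by
  decide +kernel

/-- Group `cX6`: number of certificates. -/
theorem dlen6 : data6.length = 140 := by
  decide +kernel

set_option maxHeartbeats 0 in
/-- CENSUS, group `cX6`, instances `0 … 139` (kernel-decided): each certificate decodes to a valid
perfect matching of its instance. -/
theorem census6_0 : ((((instOf cX6).zip data6).drop 0).take 140).all
    (fun p => goodD p.1 p.2) = true := by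
  decide +kernel

/-- Group `cX6`: every index is covered by a decided chunk. -/
theorem cover6 : ∀ i < data6.length, ∃ lo n, lo ≤ i ∧ i < lo + n ∧
    ((((instOf cX6).zip data6).drop lo).take n).all (fun p => goodD p.1 p.2) = true := by
  intro i hi
  rw [dlen6] at hi
  exact ⟨0, 140, by omega, by omega, census6_0⟩

set_option maxHeartbeats 0 in
/-- Group `cX7`: the certificate list has the length of the instance list (420). -/
theorem len7 : (instOf cX7).length = data7.length := by
  decide +kernel

/-- Group `cX7`: number of certificates. -/
theorem dlen7 : data7.length = 420 := by
  decide +kernel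

set_option maxHeartbeats 0 in
/-- CENSUS, group `cX7`, instances `0 … 149` (kernel-decided): each certificate decodes to a valid
perfect matching of its instance. -/
theorem census7_0 : ((((instOf cX7).zip data7).drop 0).take 150).all
    (fun p => goodD p.1 p.2) = true := by
  decide +kernel

set_option maxHeartbeats 0 in
/-- CENSUS, group `cX7`, instances `150 … 299` (kernel-decided): each certificate decodes to a valid
perfect matching of its instance. -/
theorem census7_1 : ((((instOf cX7).zip data7).drop 150).take 150).all
    (fun p => goodD p.1 p.2) = true := by
  decide +kernel

set_option maxHeartbeats 0 in
/-- CENSUS, group `cX7`, instances `300 … 419` (kernel-decided): each certificate decodes to a valid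
perfect matching of its instance. -/
theorem census7_2 : ((((instOf cX7).zip data7).drop 300).take 120).all
    (fun p => goodD p.1 p.2) = true := by
  decide +kernel

/-- Group `cX7`: every index is covered by a decided chunk. -/
theorem cover7 : ∀ i < data7.length, ∃ lo n, lo ≤ i ∧ i < lo + n ∧
    ((((instOf cX7).zip data7).drop lo).take n).all (fun p => goodD p.1 p.2) = true := by
  intro i hi
  rw [dlen7] at hi
  by_cases h0 : i < 150
  · exact ⟨0, 150, by omega, by omega, census7_0⟩
  by_cases h1 : i < 300
  · exact ⟨150, 150, by omega, by omega, census7_1⟩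
  · exact ⟨300, 120, by omega, by omega, census7_2⟩

set_option maxHeartbeats 0 in
/-- Group `cX8`: the certificate list has the length of the instance list (280). -/
theorem len8 : (instOf cX8).length = data8.length := by
  decide +kernel

/-- Group `cX8`: number of certificates. -/
theorem dlen8 : data8.length = 280 := by
  decide +kernel

set_option maxHeartbeats 0 in
/-- CENSUS, group `cX8`, instances `0 … 149` (kernel-decided): each certificate decodes to a valid
perfect matching of its instance. -/
theorem census8_0 : ((((instOf cX8).zip data8).drop 0).take 150).all
    (fun p => goodD p.1 p.2) = true := by
  decide +kernel

set_option maxHeartbeats 0 in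
/-- CENSUS, group `cX8`, instances `150 … 279` (kernel-decided): each certificate decodes to a valid
perfect matching of its instance. -/
theorem census8_1 : ((((instOf cX8).zip data8).drop 150).take 130).all
    (fun p => goodD p.1 p.2) = true := by
  decide +kernel

/-- Group `cX8`: every index is covered by a decided chunk. -/
theorem cover8 : ∀ i < data8.length, ∃ lo n, lo ≤ i ∧ i < lo + n ∧
    ((((instOf cX8).zip data8).drop lo).take n).all (fun p => goodD p.1 p.2) = true := by
  intro i hi
  rw [dlen8] at hi
  by_cases h0 : i < 150
  · exact ⟨0, 150, by omega, by omega, census8_0⟩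
  · exact ⟨150, 130, by omega, by omega, census8_1⟩

end Summit.MatrixMultiplication.MatrixMultiplication.Theorems.OutsiderSandwichToricCeilingPowTwoCwBaseCensusC
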